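import Summits.BirchSwinnertonDyer.BirchSwinnertonDyer.Theorems.ResidualThetaTransportAtTwoSemilinearDescent
import Summits.BirchSwinnertonDyer.BirchSwinnertonDyer.Theorems.ThetaPartnerAtTwoSignedTransportAtTwoResidualKummer
import Literature.NumberTheory.EllipticCurves.SubgroupSelmerProofs
import Literature.NumberTheory.EllipticCurves.H1UnramifiedFinite
import Mathlib.Algebra.Module.ZMod
import HarnessLib

/-!
# The `𝔽₂[ω]`-structure and the semilinear involution on `H¹(A, M)` induced by a commuting endomorphism and a conjugation:
# `#X = (#X^φ)²` for every stable subgroup `X ≤ H¹(A, M)` of `2`-torsion classes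
# (lead prover bsd-wall-rtt-p2 g10; `--supports stmt-BirchSwinnertonDyer-26074`; route-independent, closes nothing)

HONEST FRAMING. THEOREMS ONLY (no definition, no named fact, no instance, no `sorry`); generic continuous `H¹` algebra for a
topological group `G`, a normal subgroup `A`, a discrete `G`-module `M`; nothing about any curve or Selmer group is asserted; BSD is not
proved by any of this. No route (`Theses`) file is imported.

WHY (crux `(R≥)ᵖ` `ResidualThetaCountLowerPureAtTwo`, item stmt-BirchSwinnertonDyer-26074, CM-endpoint cards C1 /
`character-side-signed-transport` / C3 / `teichmuller-line-switch`). On the habitat `W[2]|_{Γ_K} ≅ 𝔽₄(χ̄)`: an element `τ₀ ∈ Γ_K` acting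
on `W[2]` with order `3` gives an endomorphism `e = τ₀•` with `e² + e + 1 = 0` commuting with the (abelian) `Γ_K`-action, and a complex
conjugation `c` satisfies `c e c⁻¹ = e²`. This file lifts such data to `H¹`: `ω := H¹(e)` and `φ := conj_c` on `H¹(A, M)` (`A ≤ Γ_K` normal
in `G`, e.g. `A = Γ_{K_∞}`) satisfy `ω² + ω + 1 = 0`, `φ² = 1` (`c² ∈ A`), `φω = ω²φ`; so by g9's semilinear descent (p611163,
`SemilinearDescent.natCard_eq_natCard_fixed_sq` with `R = 𝔽₂`, `3 = 1 ∈ 𝔽₂ˣ`) every `ω`- and `φ`-stable subgroup `X` of `H¹(A, M)` has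
**`#X = (#X^φ)²`** — «`dim_{𝔽₂} R(W[2]/ℚ_∞) = dim_{𝔽₄} R(W[2]/K_∞)`» once `R(W[2]/ℚ_∞) = R(W[2]/K_∞)^φ` (p618869
`resOfLe_kerSubgroup_inf_bijective_invariants`) and the local conditions are `ω`-, `φ`-stable (line-specific).

WHAT (`e : M →+ M` with `e(a•m) = a•e(m)` for `a ∈ A`; `ω_e := resH1Hom id e`, on cocycles `z ↦ e ∘ z`):
* `endoH1_oneCocycleClass` — the cocycle formula; `endoH1_sq_add_self_add_id_eq_zero` — `e² + e + 1 = 0 ⟹ ω² + ω + 1 = 0` on `H¹`;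
* `conjH1_endoH1_eq` — `σ ∘ e = e² ∘ σ` on `M` ⟹ `conj_σ ∘ ω = ω² ∘ conj_σ` on `H¹(A, M)`;
* `conjH1_conjH1_eq_self` — `σ² ∈ A ⟹ conj_σ² = 1`; `two_nsmul_subgroupH1_eq_zero` — `2M = 0 ⟹ 2·H¹(A, M) = 0`;
* **`natCard_eq_sq_natCard_fixed_of_stable`** — for an additive subgroup `X ≤ H¹(A, M)` stable under `ω` and `conj_σ`:
  `Nat.card X = (Nat.card {x : X // conj_σ x = x})²`.

References: [SerreLocalFields1979] Ch. X §1 (Galois descent); [SerreGaloisCohomology1997] I.§2.4–2.5 (functoriality, conjugation);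
[NeukirchSchmidtWingberg2008] (1.5.2), (1.6.3).
-/

set_option autoImplicit false
-- D-0017: single-problem summit, so `Summit.BirchSwinnertonDyer.BirchSwinnertonDyer.…` repeats a namespace BY DESIGN.
set_option linter.dupNamespace false

noncomputable section

open scoped Classical

open Literature.NumberTheory.EllipticCurves Literature.NumberTheory.GaloisRepresentations

namespace Summit.BirchSwinnertonDyer.BirchSwinnertonDyer.Theorems.ResidualLayer

universe u

variable {G : Type u} [Group G] [TopologicalSpace G] [IsTopologicalGroup G]
  {M : Type u} [AddCommGroup M] [DistribMulAction G M] [TopologicalSpace M] [DiscreteTopology M]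
  (A : Subgroup G) (e : M →+ M)

/-! ## §1. `ω = H¹(e)` -/

omit [IsTopologicalGroup G] [TopologicalSpace M] [DiscreteTopology M] in
/-- The compatibility making `(id_A, e)` a pair: `e (x • m) = x • e m` for `x ∈ A`. [cite: SerreGaloisCohomology1997, I.§2.4] -/
theorem endo_compat (he : ∀ (a : A) (m : M), e ((a : G) • m) = (a : G) • e m) (x : A) (m : M) :
    e (ContinuousMonoidHom.id A x • m) = x • e m :=
  he x m

/-- **`ω = H¹(e)` on cocycles**: `ω [z] = [e ∘ z]`. [cite: SerreGaloisCohomology1997, I.§2.4] -/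
theorem endoH1_oneCocycleClass (he : ∀ (a : A) (m : M), e ((a : G) • m) = (a : G) • e m) (z : contOneCocycles (discreteTopRep A M)) :
    resH1Hom (ContinuousMonoidHom.id A) e (endo_compat A e he) (oneCocycleClass _ z) =
      oneCocycleClass _ (contOneCocycles.pullback (ContinuousMonoidHom.id A)
        (resHomOfEquivariant (ContinuousMonoidHom.id A) e (endo_compat A e he)) z) :=
  map_oneCocycleClass _ _ _ z

/-- **`e² + e + 1 = 0` on `M` ⟹ `ω² + ω + 1 = 0` on `H¹(A, M)`.** [cite: SerreGaloisCohomology1997, I.§2.4] -/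
theorem endoH1_sq_add_self_add_id_eq_zero (he : ∀ (a : A) (m : M), e ((a : G) • m) = (a : G) • e m)
    (hee : ∀ m : M, e (e m) + e m + m = 0) (x : subgroupH1 A M) :
    resH1Hom (ContinuousMonoidHom.id A) e (endo_compat A e he)
        (resH1Hom (ContinuousMonoidHom.id A) e (endo_compat A e he) x) +
      resH1Hom (ContinuousMonoidHom.id A) e (endo_compat A e he) x + x = 0 := by
  obtain ⟨z, rfl⟩ := oneCocycleClass_surjective _ x
  rw [endoH1_oneCocycleClass A e he, endoH1_oneCocycleClass A e he, ← oneCocycleClass_add, ← oneCocycleClass_add]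
  have h0 : (contOneCocycles.pullback (ContinuousMonoidHom.id A)
        (resHomOfEquivariant (ContinuousMonoidHom.id A) e (endo_compat A e he))
        (contOneCocycles.pullback (ContinuousMonoidHom.id A)
          (resHomOfEquivariant (ContinuousMonoidHom.id A) e (endo_compat A e he)) z) +
      contOneCocycles.pullback (ContinuousMonoidHom.id A)
        (resHomOfEquivariant (ContinuousMonoidHom.id A) e (endo_compat A e he)) z + z) = 0 := by
    apply Subtype.ext
    ext a
    change e (e (z.1 a)) + e (z.1 a) + z.1 a = 0
    exact hee (z.1 a)
  rw [h0]
  exact oneCocycleClass_zero _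

/-! ## §2. `φ = conj_σ`: semilinearity and involutivity -/

omit [TopologicalSpace M] [DiscreteTopology M] in
/-- The compatibility of the pair `(σ⁻¹ (·) σ, σ • ·)` defining `conjH1` (as in `InvariantRestriction.conj_compat`).
[cite: SerreGaloisCohomology1997, I.§2.5] -/
theorem conj_compat' [A.Normal] (σ : G) (x : A) (v : M) :
    DistribSMul.toAddMonoidHom M σ (subgroupConj A σ x • v) = x • DistribSMul.toAddMonoidHom M σ v := by
  simp only [DistribSMul.toAddMonoidHom_apply, Subgroup.smul_def, subgroupConj_apply_coe, smul_smul,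
    mul_assoc, mul_inv_cancel_left]

/-- **`σ ∘ e = e² ∘ σ` on `M` ⟹ `conj_σ ∘ ω = ω² ∘ conj_σ` on `H¹(A, M)`** (`A` normal in `G`): on cocycles both sides are
`a ↦ σ·e?(z(σ⁻¹ a σ))`. With `e = τ₀•` (`ρ̄(τ₀)` a `3`-cycle) and `σ = c` (a transposition) this is `φω = ω²φ`.
[cite: SerreGaloisCohomology1997, I.§2.5] -/
theorem conjH1_endoH1_eq [A.Normal] (he : ∀ (a : A) (m : M), e ((a : G) • m) = (a : G) • e m) (σ : G)
    (hσe : ∀ m : M, σ • e m = e (e (σ • m))) (x : subgroupH1 A M) :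
    conjH1 A M σ (resH1Hom (ContinuousMonoidHom.id A) e (endo_compat A e he) x) =
      resH1Hom (ContinuousMonoidHom.id A) e (endo_compat A e he)
        (resH1Hom (ContinuousMonoidHom.id A) e (endo_compat A e he) (conjH1 A M σ x)) := by
  obtain ⟨z, rfl⟩ := oneCocycleClass_surjective _ x
  have hconj : ∀ w : contOneCocycles (discreteTopRep A M), conjH1 A M σ (oneCocycleClass _ w) =
      oneCocycleClass _ (contOneCocycles.pullback (subgroupConj A σ)
        (resHomOfEquivariant (subgroupConj A σ) (DistribSMul.toAddMonoidHom M σ) (conj_compat' A σ)) w) :=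
    fun w ↦ map_oneCocycleClass _ _ _ w
  rw [endoH1_oneCocycleClass A e he, hconj, hconj, endoH1_oneCocycleClass A e he, endoH1_oneCocycleClass A e he]
  congr 1
  apply Subtype.ext
  ext a
  exact hσe _

/-- **`σ² ∈ A ⟹ conj_σ` is an involution of `H¹(A, M)`** (`conj_σ ∘ conj_σ = conj_{σ²} = id`). [cite: NeukirchSchmidtWingberg2008, (1.6.3)] -/
theorem conjH1_conjH1_eq_self [A.Normal] {σ : G} (hσ : σ * σ ∈ A) (x : subgroupH1 A M) :
    conjH1 A M σ (conjH1 A M σ x) = x := by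
  rw [← AddMonoidHom.comp_apply, ← conjH1_mul_holds A M σ σ, conjH1_of_mem_holds A M hσ, AddMonoidHom.id_apply]

/-- **`2M = 0 ⟹ 2·H¹(A, M) = 0`** (tree `nsmul_discreteH1_eq_zero_of_forall`). [cite: SerreGaloisCohomology1997, I.§2.2] -/
theorem two_nsmul_subgroupH1_eq_zero (h2 : ∀ m : M, 2 • m = 0) (x : subgroupH1 A M) : 2 • x = 0 :=
  SignedTransportAtTwo.nsmul_discreteH1_eq_zero_of_forall h2 x

/-! ## §3. The count `#X = (#X^φ)²` for a stable subgroup of `2`-torsion classes -/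

/-- **`#X = (#X^{conj_σ})²` for every subgroup `X ≤ H¹(A, M)` stable under `ω = H¹(e)` and `φ = conj_σ`**, when `2M = 0`,
`e² + e + 1 = 0` on `M`, `e` commutes with `A`, `σ ∘ e = e² ∘ σ` on `M` and `σ² ∈ A`: then `X` is an `𝔽₂`-space with `𝔽₂`-linear
`ω`, `φ`, `ω² + ω + 1 = 0`, `φ² = 1`, `φω = ω²φ`, and g9's `SemilinearDescent.natCard_eq_natCard_fixed_sq` (p611163, `3·1 = 1` in `𝔽₂`)
applies. For finite `X` this reads `dim_{𝔽₂} X^φ = dim_{𝔽₄} X`. [cite: SerreLocalFields1979, Ch. X §1] -/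
theorem natCard_eq_sq_natCard_fixed_of_stable [A.Normal] (he : ∀ (a : A) (m : M), e ((a : G) • m) = (a : G) • e m) (h2 : ∀ m : M, 2 • m = 0)
    (hee : ∀ m : M, e (e m) + e m + m = 0) {σ : G} (hσ : σ * σ ∈ A) (hσe : ∀ m : M, σ • e m = e (e (σ • m)))
    (X : AddSubgroup (subgroupH1 A M))
    (hXω : ∀ x ∈ X, resH1Hom (ContinuousMonoidHom.id A) e (endo_compat A e he) x ∈ X)
    (hXφ : ∀ x ∈ X, conjH1 A M σ x ∈ X) :
    Nat.card X = Nat.card {x : X // conjH1 A M σ (x : subgroupH1 A M) = x} ^ 2 := by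
  -- `X` is an `𝔽₂`-vector space
  have h2X : ∀ x : X, 2 • x = 0 := fun x ↦ Subtype.ext (by
    rw [AddSubgroupClass.coe_nsmul, ZeroMemClass.coe_zero]; exact two_nsmul_subgroupH1_eq_zero A h2 x)
  letI : Module (ZMod 2) X := AddCommGroup.zmodModule h2X
  -- the restricted endomorphisms
  let ωa : X →+ X :=
    { toFun := fun x ↦ ⟨resH1Hom (ContinuousMonoidHom.id A) e (endo_compat A e he) x, hXω x x.2⟩
      map_zero' := Subtype.ext (map_zero _)
      map_add' := fun x y ↦ Subtype.ext (map_add _ _ _) }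
  let φa : X →+ X :=
    { toFun := fun x ↦ ⟨conjH1 A M σ x, hXφ x x.2⟩
      map_zero' := Subtype.ext (map_zero _)
      map_add' := fun x y ↦ Subtype.ext (map_add _ _ _) }
  let ω : X →ₗ[ZMod 2] X := ωa.toZModLinearMap 2
  let φ : X →ₗ[ZMod 2] X := φa.toZModLinearMap 2
  have hω : ∀ x : X, ω (ω x) + ω x + x = 0 := fun x ↦
    Subtype.ext (endoH1_sq_add_self_add_id_eq_zero A e he hee x)
  have hφ : ∀ x : X, φ (φ x) = x := fun x ↦
    Subtype.ext (conjH1_conjH1_eq_self (M := M) A hσ (x : subgroupH1 A M))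
  have hφω : ∀ x : X, φ (ω x) = ω (ω (φ x)) := fun x ↦ Subtype.ext (conjH1_endoH1_eq A e he σ hσe x)
  have ht : (3 : ZMod 2) * 1 = 1 := by decide
  rw [SemilinearDescent.natCard_eq_natCard_fixed_sq ω φ ht hω hφ hφω]
  -- the two fixed-point subtypes agree
  congr 1
  exact Nat.card_congr (Equiv.subtypeEquivRight fun x ↦ by
    change (φa x = x) ↔ _
    exact ⟨fun h ↦ congrArg Subtype.val h, fun h ↦ Subtype.ext h⟩)

end Summit.BirchSwinnertonDyer.BirchSwinnertonDyer.Theorems.ResidualLayer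

end
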